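import Summits.QuantumFields.BalabanUV.Beta.GAN24.CouplingLetterWordInputs
import Summits.QuantumFields.BalabanUV.Beta.GAN24.PerturbedInsertionChainDecay

/-!
# `BalabanUV.Beta.GAN24.CouplingWordsAtCoupling` — binder row G-an2-4 ∕ (CONV-C), route R7 «TWO CURRENCIES», PART 261: WORDS MOVE WITH THE BASE POINT.  For a FAMILY of
# perturbations `(Q_i)_{i ∈ σ}` of the free family `D_k` and a BASE perturbation `P_k` inside the Neumann disc (`‖t‖κ < 1`, `‖P_kD_k⁻¹‖, ‖D_k⁻¹P_k‖ ≤ κ`), the words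
# `T_{w,k}(t) = 𝒢_k(t)Q_{i₁,k}𝒢_k(t)Q_{i₂,k}⋯𝒢_k(t)` in the PERTURBED resolvent `𝒢_k(t) = (D_k + tP_k)⁻¹` (`= List.foldr (fun i N ↦ 𝒢_k(t)Q_{i,k}N) 𝒢_k(t) w`; the mixed
# background-derivatives of `(D + tP + Σ_i s_iQ_i)⁻¹` at `s = 0` — the Taylor coefficients of the effective form AT THE BASE POINT `tP`, e.g. the one-loop Hessian at a nonzero
# background) obey NE2's one-step law and the tower limit with rate: PART 120 moved ONE letter with the coupling (`perturbationLaws_at_coupling`: the base letter itself), PART 122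
# gave words at `t = 0`; here (§1–§2) EVERY letter `Q` with `PerturbationLaws D Q J κ′ c` survives the shift `D ↦ D + tP` with Neumann factors `ν = (1 − ‖t‖κ)⁻¹`
# (`PerturbationLaws (D + tP) Q J (κ′ν) (ν²c)`), so (§3) PART 122's `towerLimitRate_word` holds AT EVERY COUPLING of the disc for every word over the family; (§4) the
# conjugated (Combes–Thomas) letters at the base point: `‖c(Q)c(𝒢(t))‖ ≤ κ_Q·ν_c` and `‖c(T_w(t))‖ ≤ γ_w⁻¹ν_c(κ_Qν_c)^{|w|}` (PART 159 §3 at `t ≠ 0`) — the two operator-currency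
# inputs of the (UD)+(SR) dictionary for words at a base point (unit b2b-balaban-gan24-p3, gen 67; v1)

NOT IN PRINT; OUR PROOF ([folklore] Neumann-factor algebra BY NAME over PART 120 (`opNorm_F_mul_perturbed_le`, `opNorm_perturbed_mul_F_le`, `freeTowerLaws_at_coupling`), PART 122
(`towerLimitRate_word`, `chain_eq_mul_tailProd`), NE2's `BackgroundResolventLaw` (`opNorm_mul_inv_add_smul_le`, `opNorm_inv_add_smul_mul_le`, `l2_opNorm_one_le`) and
`CTAveragedTowerDecay` (`isUnit_det_conjMat_of_wCoercive`, `opNorm_conjMat_pertInv_le_of_wCoercive`, `conjMat_mul_same`), `CTConjugationPieces.conjMat_inv`,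
`CTWeightedCoercivity.conjMat_add ∕ _smul ∕ _one`; nothing printed is a hypothesis).
HONEST FRAMING (cell contract, verbatim): «discharging `BetaPertH` makes Bałaban's UV stability UNCONDITIONAL — a real constructive-QFT result; it is NOT the
continuum limit and NOT the Clay problem.»  HONEST DEPENDENCY (verbatim): «continuum YM on T⁴ ⇐ BetaPertH ∧ nine spine estimates (0/9 proved); BetaPertH ⇐
(D1) ∧ (D4) ∧ CAP+tail; G-an2-4 gates asym, D1 and NE2/3/4.»

WHAT THIS FILE PROVES (0 sorry, 0 `def`; `ν = (1 − ‖t‖κ)⁻¹`):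
* §1 (two levels, GENERIC) `opNorm_perturbed_sandwich_le` (`‖(D′ + tP′)⁻¹M(D + tP)⁻¹‖ ≤ ν·e·ν` whenever `‖D′⁻¹MD⁻¹‖ ≤ e` — PART 120's consistency step for ANY middle factor).
* §2 (a tower, GENERIC) **`perturbationLaws_shift`**: `FreeTowerLaws D …`, `PerturbationLaws D P J κ e₂`, `PerturbationLaws D Q J κ′ c`, `‖t‖κ < 1` ⟹
  `PerturbationLaws (k ↦ D_k + tP_k) Q J (κ′ν) (ν²c)`.
* §3 **`towerLimitRate_word_at_coupling`**: geometric letters ⟹ for EVERY word `w` over a family `Q_i` with uniform `(κ′, c)` and EVERY `‖t‖κ < 1`,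
  `TowerLimitRate A r (k ↦ T_{w,k}(t)) ((|w|+1)(κ′ν)^{|w|}(C₁ + ‖t‖C₂)ν² + |w|(κ′ν)^{|w|−1}ν²C₂′ + (κ′ν)^{|w|}(νC₀ + 2νC_f)) ρ`.
* §4 (GENERIC, one level) **`opNorm_conjMat_letter_mul_pertInv_le`** (`‖c(Q)c((D + tP)⁻¹)‖ ≤ κ_Q(1 − ‖t‖κ_P)⁻¹`), **`opNorm_conjMat_wordAt_le`**
  (`‖c(T_w(t))‖ ≤ γ_w⁻¹(1 − ‖t‖κ_P)⁻¹·(κ_Q(1 − ‖t‖κ_P)⁻¹)^{|w|}` under `WCoercive D κ ρ γ_w`).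
WHAT IT DOES NOT DO: the (UD)+(SR) ∕ EL₂ dictionaries on Bałaban's tower for coupling letters at a base point (the next PARTs); nothing about Bałaban's kernels is asserted.
SUPPLIER work; NEVER «G-an2-4 closed»; NOT (CONV-C), NOT D1, NOT `BetaPertH`, NOT continuum, NOT Clay.  Records: `HOME/b2b-balaban-gan24-p3/gen67/README.md`.
-/

noncomputable section

open scoped BigOperators ComplexConjugate Matrix Matrix.Norms.L2Operator
open Filter Topology

namespace Summit.QuantumFields.BalabanUV.Beta.GAN24.CouplingWordsAtCoupling

open Summit.QuantumFields.BalabanUV.T4Continuum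
open Summit.QuantumFields.BalabanUV.T4Continuum.BackgroundResolventLaw (opNorm_mul_inv_add_smul_le opNorm_inv_add_smul_mul_le l2_opNorm_one_le)
open Summit.QuantumFields.BalabanUV.T4Continuum.CovariantAveragingTower (TowerLimitRate)
open Summit.QuantumFields.BalabanUV.T4Continuum.BackgroundResolventTower (FreeTowerLaws PerturbationLaws)
open Summit.QuantumFields.BalabanUV.T4Continuum.CTWeightedCoercivity (conjMat conjMat_add conjMat_smul conjMat_one WCoercive)
open Summit.QuantumFields.BalabanUV.T4Continuum.CTConjugationPieces (conjMat_inv)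
open Summit.QuantumFields.BalabanUV.T4Continuum.CTAveragedTowerDecay (opNorm_conjMat_pertInv_le_of_wCoercive isUnit_det_conjMat_of_wCoercive conjMat_mul_same)
open Summit.QuantumFields.BalabanUV.Beta.GAN24.InsertionChainLawCoupling (opNorm_F_mul_perturbed_le opNorm_perturbed_mul_F_le freeTowerLaws_at_coupling)
open Summit.QuantumFields.BalabanUV.Beta.GAN24.InsertionChainLawWords (chain_eq_mul_tailProd towerLimitRate_word)

/-! ## §1 Two levels: the consistency sandwich at coupling `t` for ANY middle factor -/

section TwoLevel

variable {m n : Type*} [Fintype m] [DecidableEq m] [Fintype n] [DecidableEq n]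
variable {D P : Matrix n n ℂ} {D' P' : Matrix m m ℂ}

/-- **`opNorm_perturbed_sandwich_le`** — `‖(D′ + tP′)⁻¹·M·(D + tP)⁻¹‖ ≤ (1 − ‖t‖κ)⁻¹·e·(1 − ‖t‖κ)⁻¹` whenever `‖D′⁻¹MD⁻¹‖ ≤ e`, `‖PD⁻¹‖, ‖D′⁻¹P′‖ ≤ κ`, `‖t‖κ < 1`:
`(D′ + tP′)⁻¹M(D + tP)⁻¹ = ((D′ + tP′)⁻¹D′)(D′⁻¹MD⁻¹)(D(D + tP)⁻¹)` and the two Neumann factors (PART 120's `opNorm_perturbed_consistency_le` is `M = P′J − JP`). [our proof] -/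
theorem opNorm_perturbed_sandwich_le (hD : IsUnit D.det) (hD' : IsUnit D'.det) {t : ℂ} {κ e : ℝ} (hP : ‖P * D⁻¹‖ ≤ κ) (hP' : ‖D'⁻¹ * P'‖ ≤ κ)
    (ht : ‖t‖ * κ < 1) {M : Matrix m n ℂ} (hM : ‖D'⁻¹ * M * D⁻¹‖ ≤ e) :
    ‖(D' + t • P')⁻¹ * M * (D + t • P)⁻¹‖ ≤ (1 - ‖t‖ * κ)⁻¹ * e * (1 - ‖t‖ * κ)⁻¹ := by
  have eq : ((D' + t • P')⁻¹ * D') * (D'⁻¹ * M * D⁻¹) * (D * (D + t • P)⁻¹) = (D' + t • P')⁻¹ * M * (D + t • P)⁻¹ := by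
    calc ((D' + t • P')⁻¹ * D') * (D'⁻¹ * M * D⁻¹) * (D * (D + t • P)⁻¹)
        = (D' + t • P')⁻¹ * (D' * D'⁻¹) * M * (D⁻¹ * D) * (D + t • P)⁻¹ := by simp only [Matrix.mul_assoc]
      _ = (D' + t • P')⁻¹ * M * (D + t • P)⁻¹ := by
          rw [Matrix.mul_nonsing_inv D' hD', Matrix.nonsing_inv_mul D hD, Matrix.mul_one, Matrix.mul_one]
  rw [← eq]
  have hν : 0 ≤ (1 - ‖t‖ * κ)⁻¹ := inv_nonneg.mpr (sub_nonneg.mpr ht.le)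
  have he : 0 ≤ e := (norm_nonneg _).trans hM
  calc _ ≤ ‖(D' + t • P')⁻¹ * D' * (D'⁻¹ * M * D⁻¹)‖ * ‖D * (D + t • P)⁻¹‖ := Matrix.l2_opNorm_mul _ _
    _ ≤ ‖(D' + t • P')⁻¹ * D'‖ * ‖D'⁻¹ * M * D⁻¹‖ * ‖D * (D + t • P)⁻¹‖ := mul_le_mul_of_nonneg_right (Matrix.l2_opNorm_mul _ _) (norm_nonneg _)
    _ ≤ (1 - ‖t‖ * κ)⁻¹ * e * (1 - ‖t‖ * κ)⁻¹ :=
        mul_le_mul (mul_le_mul (opNorm_inv_add_smul_mul_le hD' hP' ht) hM (norm_nonneg _) hν) (opNorm_mul_inv_add_smul_le hD hP ht) (norm_nonneg _)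
          (mul_nonneg hν he)

omit [Fintype m] [DecidableEq m] in
/-- (H-bd) at coupling `t`, left, for ANOTHER letter: `‖(D + tP)⁻¹Q‖ ≤ (1 − ‖t‖κ)⁻¹·κ′` (PART 120's `opNorm_perturbed_mul_F_le` at `F = Qᴴ`). [our proof] -/
theorem opNorm_perturbed_mul_letter_le (hD : IsUnit D.det) {t : ℂ} {κ κ' : ℝ} (hPl : ‖D⁻¹ * P‖ ≤ κ) (ht : ‖t‖ * κ < 1) {Q : Matrix n n ℂ}
    (hQ : ‖D⁻¹ * Q‖ ≤ κ') : ‖(D + t • P)⁻¹ * Q‖ ≤ (1 - ‖t‖ * κ)⁻¹ * κ' := by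
  have hQ' : ‖D⁻¹ * (Qᴴ)ᴴ‖ ≤ κ' := by rwa [Matrix.conjTranspose_conjTranspose]
  have h := opNorm_perturbed_mul_F_le hD hPl ht hQ'
  rwa [Matrix.conjTranspose_conjTranspose] at h

end TwoLevel

/-! ## §2 Along a tower: EVERY letter survives the shift of the base point -/

section Tower

variable {ι : ℕ → Type*} [∀ k, Fintype (ι k)] [∀ k, DecidableEq (ι k)]
variable {D P : (k : ℕ) → Matrix (ι k) (ι k) ℂ} {A : (k : ℕ) → Matrix (ι k) (ι (k + 1)) ℂ}
  {J : (k : ℕ) → Matrix (ι (k + 1)) (ι k) ℂ} {F : (k : ℕ) → Matrix (ι k) (ι k) ℂ} {r κ : ℝ} {e₀ e₁ e₂ f : ℕ → ℝ}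

/-- **`perturbationLaws_shift` — EVERY PERTURBATION LETTER SURVIVES THE SHIFT `D_k ↦ D_k + tP_k`** [our proof]: `PerturbationLaws D Q J κ′ c` and the base letter's
`PerturbationLaws D P J κ e₂` with `‖t‖κ < 1` give `PerturbationLaws (k ↦ D_k + tP_k) Q J (κ′ν) (ν²c)`, `ν = (1 − ‖t‖κ)⁻¹` — (H-bd) by the one-sided Neumann factors, (H-cons) by
§1's sandwich (PART 120's `perturbationLaws_at_coupling` is `Q = P`). -/
theorem perturbationLaws_shift (hfree : FreeTowerLaws D A J F r e₀ e₁ f) (hpert : PerturbationLaws D P J κ e₂) {Q : (k : ℕ) → Matrix (ι k) (ι k) ℂ} {κ' : ℝ} {c : ℕ → ℝ}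
    (hQ : PerturbationLaws D Q J κ' c) {t : ℂ} (ht : ‖t‖ * κ < 1) :
    PerturbationLaws (fun k => D k + t • P k) Q J (κ' * (1 - ‖t‖ * κ)⁻¹) (fun k => ((1 - ‖t‖ * κ)⁻¹) ^ 2 * c k) where
  opNorm_P_mul_inv_le := fun k => opNorm_F_mul_perturbed_le (hfree.isUnit_det k) (hpert.opNorm_P_mul_inv_le k) ht (hQ.opNorm_P_mul_inv_le k)
  opNorm_inv_mul_P_le := fun k => by
    rw [mul_comm]
    exact opNorm_perturbed_mul_letter_le (hfree.isUnit_det k) (hpert.opNorm_inv_mul_P_le k) ht (hQ.opNorm_inv_mul_P_le k)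
  consistent_le := fun k => by
    have h := opNorm_perturbed_sandwich_le (hfree.isUnit_det k) (hfree.isUnit_det (k + 1)) (hpert.opNorm_P_mul_inv_le k) (hpert.opNorm_inv_mul_P_le (k + 1)) ht
      (hQ.consistent_le k)
    calc _ ≤ (1 - ‖t‖ * κ)⁻¹ * c k * (1 - ‖t‖ * κ)⁻¹ := h
      _ = ((1 - ‖t‖ * κ)⁻¹) ^ 2 * c k := by ring

/-! ## §3 Every word over the family, at every coupling of the disc -/

/-- **`towerLimitRate_word_at_coupling`** [our proof]: geometric letters (`e₀, e₁, f ≤ C·ρ^k` for the free bundle, `e₂ ≤ C₂ρ^k` for the base letter, `c ≤ C₂′ρ^k` for the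
family), `ρ < 1`, `r > 0`, `‖t‖κ < 1` ⟹ for EVERY word `w` over the family `Q_i` (uniform `κ′ ≥ 0`, `c ≥ 0`) the unit-lattice images of
`T_{w,k}(t) = 𝒢_k(t)Q_{i₁,k}𝒢_k(t)⋯𝒢_k(t)`, `𝒢_k(t) = (D_k + tP_k)⁻¹`, converge at the values' rate `ρ` with the displayed constant (`ν = (1 − ‖t‖κ)⁻¹`) — PART 122's
`towerLimitRate_word` on PART 120's shifted free bundle and §2's shifted letters. -/
theorem towerLimitRate_word_at_coupling (hr : 0 < r) (hfree : FreeTowerLaws D A J F r e₀ e₁ f) (hpert : PerturbationLaws D P J κ e₂) {σ : Type*}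
    {Q : σ → (k : ℕ) → Matrix (ι k) (ι k) ℂ} {κ' : ℝ} {c : ℕ → ℝ} (hQ : ∀ i, PerturbationLaws D (Q i) J κ' c) (hκ' : 0 ≤ κ') (hc : ∀ k, 0 ≤ c k)
    {ρ C₀ C₁ C₂ C₂' Cf : ℝ} (hρ1 : ρ < 1) (h₀ : ∀ k, e₀ k ≤ C₀ * ρ ^ k) (h₁ : ∀ k, e₁ k ≤ C₁ * ρ ^ k) (h₂ : ∀ k, e₂ k ≤ C₂ * ρ ^ k) (h₂' : ∀ k, c k ≤ C₂' * ρ ^ k)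
    (hf : ∀ k, f k ≤ Cf * ρ ^ k) {t : ℂ} (ht : ‖t‖ * κ < 1) (w : List σ) :
    TowerLimitRate A r (fun k => List.foldr (fun i N => (D k + t • P k)⁻¹ * Q i k * N) (D k + t • P k)⁻¹ w)
      (((w.length + 1) * (κ' * (1 - ‖t‖ * κ)⁻¹) ^ w.length * ((C₁ + ‖t‖ * C₂) * ((1 - ‖t‖ * κ)⁻¹) ^ 2)
          + w.length * (κ' * (1 - ‖t‖ * κ)⁻¹) ^ (w.length - 1) * (((1 - ‖t‖ * κ)⁻¹) ^ 2 * C₂'))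
        + (κ' * (1 - ‖t‖ * κ)⁻¹) ^ w.length * ((1 - ‖t‖ * κ)⁻¹ * C₀ + 2 * (Cf * (1 - ‖t‖ * κ)⁻¹))) ρ := by
  have hν : 0 ≤ (1 - ‖t‖ * κ)⁻¹ := inv_nonneg.mpr (sub_nonneg.mpr ht.le)
  refine towerLimitRate_word hr (freeTowerLaws_at_coupling hfree hpert ht) (fun i => perturbationLaws_shift hfree hpert (hQ i) ht) (mul_nonneg hκ' hν)
    (fun k => mul_nonneg (pow_nonneg hν 2) (hc k)) hρ1 (fun k => ?_) (fun k => ?_) (fun k => ?_) (fun k => ?_) w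
  · calc (1 - ‖t‖ * κ)⁻¹ * e₀ k ≤ (1 - ‖t‖ * κ)⁻¹ * (C₀ * ρ ^ k) := mul_le_mul_of_nonneg_left (h₀ k) hν
      _ = (1 - ‖t‖ * κ)⁻¹ * C₀ * ρ ^ k := by ring
  · have hsum : e₁ k + ‖t‖ * e₂ k ≤ (C₁ + ‖t‖ * C₂) * ρ ^ k := by
      have := mul_le_mul_of_nonneg_left (h₂ k) (norm_nonneg t)
      nlinarith [h₁ k]
    calc (e₁ k + ‖t‖ * e₂ k) * ((1 - ‖t‖ * κ)⁻¹) ^ 2 ≤ ((C₁ + ‖t‖ * C₂) * ρ ^ k) * ((1 - ‖t‖ * κ)⁻¹) ^ 2 :=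
          mul_le_mul_of_nonneg_right hsum (pow_nonneg hν 2)
      _ = (C₁ + ‖t‖ * C₂) * ((1 - ‖t‖ * κ)⁻¹) ^ 2 * ρ ^ k := by ring
  · calc ((1 - ‖t‖ * κ)⁻¹) ^ 2 * c k ≤ ((1 - ‖t‖ * κ)⁻¹) ^ 2 * (C₂' * ρ ^ k) := mul_le_mul_of_nonneg_left (h₂' k) (pow_nonneg hν 2)
      _ = ((1 - ‖t‖ * κ)⁻¹) ^ 2 * C₂' * ρ ^ k := by ring
  · calc f k * (1 - ‖t‖ * κ)⁻¹ ≤ (Cf * ρ ^ k) * (1 - ‖t‖ * κ)⁻¹ := mul_le_mul_of_nonneg_right (hf k) hν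
      _ = Cf * (1 - ‖t‖ * κ)⁻¹ * ρ ^ k := by ring

end Tower

/-! ## §4 The conjugated letters and words at the base point -/

section Conj

variable {ι : Type*} [Fintype ι] [DecidableEq ι]

/-- **`opNorm_conjMat_letter_mul_pertInv_le` — the conjugated (H-bd) of ANOTHER letter at coupling `t`**: `WCoercive D κ ρ γ_w`, `‖c(P)c(D⁻¹)‖ ≤ κ_P`, `‖c(Q)c(D⁻¹)‖ ≤ κ_Q`,
`‖t‖κ_P < 1` ⟹ `‖c(Q)·c((D + tP)⁻¹)‖ ≤ κ_Q(1 − ‖t‖κ_P)⁻¹` (`c` multiplicative, commutes with inversion; PART 120's right Neumann factor on the conjugated pair; PART 162 §1 is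
`Q = P`). [folklore] -/
theorem opNorm_conjMat_letter_mul_pertInv_le {D P Q : Matrix ι ι ℂ} {κ : ℝ} {ρ : ι → ℝ} {γw κP κQ : ℝ} (hW : WCoercive D κ ρ γw) (hγ : 0 < γw)
    (hP : ‖conjMat κ ρ ρ P * conjMat κ ρ ρ D⁻¹‖ ≤ κP) (hQ : ‖conjMat κ ρ ρ Q * conjMat κ ρ ρ D⁻¹‖ ≤ κQ) {t : ℂ} (ht : ‖t‖ * κP < 1) :
    ‖conjMat κ ρ ρ Q * conjMat κ ρ ρ (D + t • P)⁻¹‖ ≤ κQ * (1 - ‖t‖ * κP)⁻¹ := by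
  have hD := isUnit_det_conjMat_of_wCoercive hW hγ
  rw [conjMat_inv] at hP hQ
  have h := opNorm_F_mul_perturbed_le hD hP ht hQ
  rwa [← conjMat_smul, ← conjMat_add, ← conjMat_inv] at h

/-- **`opNorm_conjMat_wordAt_le` — the conjugated bound of a word AT THE BASE POINT**: `‖c(𝒢(t)Q_{i₁}𝒢(t)⋯𝒢(t))‖ ≤ γ_w⁻¹ν_c·(κ_Qν_c)^{|w|}`, `ν_c = (1 − ‖t‖κ_P)⁻¹`
(`T_w(t) = 𝒢(t)·R_w(t)` by PART 122's right shift; NE2's conjugated Neumann bound for `c(𝒢(t))`; PART 159 §3 is `t = 0`). [folklore] -/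
theorem opNorm_conjMat_wordAt_le {D P : Matrix ι ι ℂ} {κ : ℝ} {ρ : ι → ℝ} {γw κP κQ : ℝ} {σ : Type*} {Q : σ → Matrix ι ι ℂ} (hW : WCoercive D κ ρ γw) (hγ : 0 < γw)
    (hκQ : 0 ≤ κQ) (hP : ‖conjMat κ ρ ρ P * conjMat κ ρ ρ D⁻¹‖ ≤ κP) (hQ : ∀ i, ‖conjMat κ ρ ρ (Q i) * conjMat κ ρ ρ D⁻¹‖ ≤ κQ) {t : ℂ} (ht : ‖t‖ * κP < 1)
    (w : List σ) :
    ‖conjMat κ ρ ρ (List.foldr (fun i N => (D + t • P)⁻¹ * Q i * N) (D + t • P)⁻¹ w)‖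
      ≤ γw⁻¹ * (1 - ‖t‖ * κP)⁻¹ * (κQ * (1 - ‖t‖ * κP)⁻¹) ^ w.length := by
  have hν : 0 ≤ (1 - ‖t‖ * κP)⁻¹ := inv_nonneg.mpr (sub_nonneg.mpr ht.le)
  have htail : ∀ w : List σ, ‖conjMat κ ρ ρ (List.foldr (fun i N => Q i * (D + t • P)⁻¹ * N) 1 w)‖ ≤ (κQ * (1 - ‖t‖ * κP)⁻¹) ^ w.length := by
    intro w
    induction w with
    | nil => rw [List.foldr_nil, conjMat_one, List.length_nil, pow_zero]; exact l2_opNorm_one_le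
    | cons i w ih =>
      rw [List.foldr_cons, conjMat_mul_same, conjMat_mul_same κ ρ (Q i), List.length_cons, pow_succ']
      exact (Matrix.l2_opNorm_mul _ _).trans (mul_le_mul (opNorm_conjMat_letter_mul_pertInv_le hW hγ hP (hQ i) ht) ih (norm_nonneg _) (mul_nonneg hκQ hν))
  rw [chain_eq_mul_tailProd, conjMat_mul_same]
  exact (Matrix.l2_opNorm_mul _ _).trans
    (mul_le_mul (opNorm_conjMat_pertInv_le_of_wCoercive hW hγ hP ht) (htail w) (norm_nonneg _) (mul_nonneg (inv_nonneg.mpr hγ.le) hν))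

end Conj

end Summit.QuantumFields.BalabanUV.Beta.GAN24.CouplingWordsAtCoupling

end
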